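import Literature.AnabelianGeometry.AbsoluteAnabelian.AbsTopIProp410Sub

/-!
# [AbsTopI] Prop 4.10 (iii), row iii.L05 conjunct 1 as typed (`CoFreeCofinalAlong`): PREIMAGE
# cofinality versus the kernel of a de-cuspidalization — kernel certificates for finding F-w5d011-1

S. Mochizuki, *Topics in Absolute Anabelian Geometry I: Generalities* [AbsTopI] (bib
`MochizukiAbsTopI2012`; manuscript `paper:url-11ac98ba15fc`), §0 p. 8 (the co-free completion
`Π^{Q/co-fr} := lim_H Im_Q(Π/H^{co-fr})`, `H` ranging over the characteristic open subgroups of finite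
index of `Δ`) and Prop 4.10 (iii) p. 60.

The cell's row iii.L05 `AbsTopI.Prop410.CoFreeCofinalAlong E kitX` (`AbsTopIProp410Sub.lean`, p414417)
types, as its FIRST conjunct, a PREIMAGE cofinality along a de-cuspidalization `f : Π^tp_X → Π^tp_Y`
(`E : DeCuspidalization X Y`, filling the `k`-rational cusp `x`):

  `∀ H ≤ Δ^tp_X` characteristic open of finite index, `∃ H′ ≤ Δ^tp_Y` characteristic open of finite
  index with `f⁻¹(H′) ≤ H`.

Finding F-w5d011-1 (abc-iut-w5-d011; plan/GAP-LEDGER.md G-w5d011-3; L4-lead RULING #3 (4)(iv);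
recorded in the row's own docstring) observes that this is SUSPECT-TOO-STRONG at the intended data:
every preimage `f⁻¹(H′)` contains `Ker f`, which contains the inertia group `I_x` of the filled cusp,
whereas a characteristic open finite-index `H ⊆ Δ^tp_X` may OMIT `I_x` (e.g. `H = Ker(Δ^tp_X →
H₁(Δ^tp_X, ℤ/l))` whenever the class of the cusp is not `l`-divisible — always so if `Y` keeps a further
cusp).  The ledger row records «no kernel countermodel filed (would need a concrete
TemperedCurve/DeCuspidalization instance — campaign-L)».

This proof-only file (no definitions) supplies the CONDITIONAL kernel certificates, over the abstract
data, in the style of `AbsTopII/Prop13ConjugacyScope.lean` / `AbsTopII/Prop13iiDiagonalScope.lean`: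
* `DeCuspidalization.inertia_le_ker` — FROM THE RECORD'S OWN FIELDS: the inertia group `I_x` of the
  filled cusp lies in `Ker f` (`toHat_comp`, `ker_fHat ⊇` the normal closure of `toHat(I_x)`, and
  injectivity of `toHat_Y`);
* `ker_le_of_coFreeCofinalAlong` — conjunct 1 forces `Ker f ≤ H` for EVERY characteristic open
  finite-index `H ⊆ Δ^tp_X`, hence (`inertia_le_of_coFreeCofinalAlong`) `I_x ≤ H` for every such `H`;
* `not_coFreeCofinalAlong_of_inertia_not_le` — so `CoFreeCofinalAlong E kitX` FAILS as soon as ONE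
  characteristic open finite-index `H ⊆ Δ^tp_X` omits `I_x` (the model situation of F-w5d011-1),
  for every kit `kitX`; likewise `not_coFreeCofinalAlong_of_ker_not_le`.
Nothing here bears on conjunct 2 (monotonicity, a theorem at the construction: `cofreeCore_mono`) nor
on the print-faithful IMAGE form `CoFreeCofinalImAlong` / `CoFreeKernelCofinalAlong`
(`AbsTopIProp410CoFreeBridge.lean`, `AbsTopIProp410SubRows.lean`), which consumers use.
HONEST FRAMING: a statement-faithfulness certificate about the cell's own typing (row iii.L05 is
«OURS», not a printed sentence); it says nothing about the truth of [AbsTopI] Prop 4.10 and nothing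
about [IUTchIII] Cor 3.12.  Typed ≠ proved.  Drafted by abc-iut-w5-d102 (gen 5).
-/

noncomputable section

open scoped Pointwise

namespace Literature.AnabelianGeometry.AbsoluteAnabelian

open Literature.AnabelianGeometry.SemiGraphs

namespace AbsTopI.Prop410

variable {p : ℕ} [Fact p.Prime]

/-- **`I_x ≤ Ker f`** for a de-cuspidalization record: the inertia group of the filled cusp dies
under the tempered `f` — from `toHat_Y ∘ f = f̂ ∘ toHat_X`, `Ker f̂ ⊇ ⟪toHat_X(I_x)⟫` (field
`ker_fHat`) and injectivity of `toHat_Y`. [cite: MochizukiAbsTopI2012, Def 4.2 (i) p.49] -/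
theorem DeCuspidalization.inertia_le_ker {X Y : TemperedCurve p} (E : DeCuspidalization X Y) :
    X.inertia E.x ≤ E.f.toMonoidHom.ker := by
  intro g hg
  rw [MonoidHom.mem_ker]
  change E.f g = 1
  have h1 : X.toHat g ∈ E.fHat.toMonoidHom.ker := by
    rw [E.ker_fHat]
    exact Subgroup.le_topologicalClosure _
      (Subgroup.subset_normalClosure (Subgroup.mem_map_of_mem X.toHat.toMonoidHom hg))
  rw [MonoidHom.mem_ker] at h1
  change E.fHat (X.toHat g) = 1 at h1
  apply Y.toHat_injective
  rw [map_one, E.toHat_comp g, h1]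

/-- **Conjunct 1 of `CoFreeCofinalAlong` forces `Ker f ≤ H`** for every characteristic open
finite-index `H ⊆ Δ^tp_X`: the witness `H′` has `Ker f = f⁻¹(1) ≤ f⁻¹(H′) ≤ H`.
[cite: MochizukiAbsTopI2012, §0 p.8] -/
theorem ker_le_of_coFreeCofinalAlong {X Y : TemperedCurve p} {E : DeCuspidalization X Y}
    {kitX : CoFreeQKit X Y.PiHat E.fHat} (h : CoFreeCofinalAlong E kitX)
    {H : Subgroup X.PiTemp} (hH : IsCharOpenFiniteIndexInDelta X H) :
    E.f.toMonoidHom.ker ≤ H := by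
  obtain ⟨H', -, hle⟩ := h.1 H hH
  exact le_trans (fun g hg => by
    rw [MonoidHom.mem_ker] at hg
    show g ∈ H'.comap E.f.toMonoidHom
    rw [Subgroup.mem_comap, hg]
    exact H'.one_mem) hle

/-- **… hence `I_x ≤ H`** for every characteristic open finite-index `H ⊆ Δ^tp_X`.
[cite: MochizukiAbsTopI2012, §0 p.8] -/
theorem inertia_le_of_coFreeCofinalAlong {X Y : TemperedCurve p} {E : DeCuspidalization X Y}
    {kitX : CoFreeQKit X Y.PiHat E.fHat} (h : CoFreeCofinalAlong E kitX)
    {H : Subgroup X.PiTemp} (hH : IsCharOpenFiniteIndexInDelta X H) :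
    X.inertia E.x ≤ H :=
  E.inertia_le_ker.trans (ker_le_of_coFreeCofinalAlong h hH)

/-- **Certificate (F-w5d011-1), kernel form.** `CoFreeCofinalAlong E kitX` AS TYPED FAILS, for every
kit, as soon as some characteristic open finite-index `H ⊆ Δ^tp_X` does not contain `Ker f`.
[cite: MochizukiAbsTopI2012, §0 p.8] -/
theorem not_coFreeCofinalAlong_of_ker_not_le {X Y : TemperedCurve p} (E : DeCuspidalization X Y)
    (kitX : CoFreeQKit X Y.PiHat E.fHat) {H : Subgroup X.PiTemp}
    (hH : IsCharOpenFiniteIndexInDelta X H) (hker : ¬ E.f.toMonoidHom.ker ≤ H) :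
    ¬ CoFreeCofinalAlong E kitX :=
  fun h => hker (ker_le_of_coFreeCofinalAlong h hH)

/-- **Certificate (F-w5d011-1), inertia form — the model situation.** `CoFreeCofinalAlong E kitX` AS
TYPED FAILS, for every kit, as soon as some characteristic open finite-index `H ⊆ Δ^tp_X` OMITS the
inertia group `I_x` of the filled cusp (at a genuine de-cuspidalization with `Y` keeping a further
cusp: `H = Ker(Δ^tp_X → H₁(Δ^tp_X, ℤ/l))`, the cusp class not being `l`-divisible — finding
F-w5d011-1's witness).  The print-faithful replacement is the IMAGE form `CoFreeCofinalImAlong`.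
[cite: MochizukiAbsTopI2012, Prop 4.10 (iii) p.60] -/
theorem not_coFreeCofinalAlong_of_inertia_not_le {X Y : TemperedCurve p} (E : DeCuspidalization X Y)
    (kitX : CoFreeQKit X Y.PiHat E.fHat) {H : Subgroup X.PiTemp}
    (hH : IsCharOpenFiniteIndexInDelta X H) (hx : ¬ X.inertia E.x ≤ H) :
    ¬ CoFreeCofinalAlong E kitX :=
  fun h => hx (inertia_le_of_coFreeCofinalAlong h hH)

end AbsTopI.Prop410

end Literature.AnabelianGeometry.AbsoluteAnabelian

end
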